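import Literature.Barriers.CriticalPhenomena.TimarNonunimodularLevels
import HarnessLib

/-!
# The nonunimodular mass-transport principle for QUASI-TRANSITIVE graphs (Timár 2006, Lemma 2.2
# in quasi-transitive form; Lyons–Peres 2016, (8.10) summed over orbit representatives) — PROVED

Barrier catalogue `Literature/Barriers/CriticalPhenomena/`; a brick of the programme behind the
named fact `Timar2006_atMostOneCriticalCluster` (`SubexponentialGrowthZdUniqueness.lean`), the
quasi-transitive wording (Hutchcroft 2016, §2) of Timár's Cor. 5.7, which is the last input of
`Hutchcroft2016_noPercolationAtCriticality`. Every mass-transport step of Timár's §§4–5 (Lemma 4.2,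
Lemma 5.1, Lemma 5.2, Lemma 5.3, Cor. 5.10) invokes his Lemma 2.2, the nonunimodular MTP for a
TRANSITIVE graph: "`Σ_y f(x, y) = w(x)⁻¹ Σ_y f(y, x) w(y)`" (proved in the tree,
`tsum_eq_inv_autWeight_mul_tsum`, `TimarNonunimodularLevels.lean`). Its quasi-transitive form is
what the quasi-transitive case of those steps needs (Lyons–Peres 2016, p. 234: results for
quasi-transitive graphs "can be deduced in a similar fashion but with some additional attention to
details"); it is Lyons–Peres (8.10), "`Σ_{z ∈ Γw} f(u, z) μ_w = Σ_{y ∈ Γu} f(y, w) μ_y`", summed over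
a complete set of orbit representatives exactly as in the printed proof of Cor. 8.11 ("for each
`i` and `j`, (8.10) gives … Adding these equations over all `i` and `j` gives the desired result"),
WITHOUT the unimodularity that makes `μ` constant on orbits there. What survives of `μ_y` on the
right-hand side is its position inside its orbit, the **relative weight**
`Δ(y) := μ_y / μ_{o(y)} = w_{o(y)}(y)` (`relWeight`; `o(y)` the representative of the orbit of
`y`, `orbitRep`), which is `≡ 1` in the unimodular case (recovering Cor. 8.11) and is Timár's
`w(y)` (with `w(o) = 1`) in the transitive case (recovering Lemma 2.2):

* `orbitRep`, `relWeight` and their API (`orbitRep_map`: representatives are `Aut(G)`-invariant;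
  `relWeight_mul_autWeight_orbitRep`: `Δ(y) μ_{o(y)} = μ_y`; `relWeight_eq_one_of_mem`;
  `relWeight_singleton`; `relWeight_eq_one_of_isGraphUnimodular`);
* `inv_autWeight_mul_tsum_autOrbit_eq_tilted` — the two-orbit identity
  `μ_i⁻¹ Σ_{z ∈ Γo_j} f(o_i, z) = μ_j⁻¹ Σ_{y ∈ Γo_i} f(y, o_j) w_{o_i}(y)` ((8.10) divided by
  `μ_i μ_j`);
* `sum_inv_autWeight_mul_tsum_eq_tilted` — **the quasi-transitive nonunimodular MTP**:
  for `G` connected, locally finite, `{o_1, …, o_L}` a complete set of orbit representatives of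
  `Aut(G)`, `μ_i` the weights of Thm. 8.10 and `f : V × V → [0, ∞]` diagonally invariant,
  `Σ_i μ_i⁻¹ Σ_z f(o_i, z) = Σ_j μ_j⁻¹ Σ_y f(y, o_j) Δ(y)`;
* `sum_inv_autWeight_mul_lintegral_tsum_eq_tilted` — the same for invariant random transports
  `F(x, y; ω)` on a measure space preserved by the action (Timár: "`x` sends mass `φ(x, y; ω)` to
  `y` when `ω`"), `Σ_i μ_i⁻¹ E[Σ_x F(o_i, x; ω)] = Σ_j μ_j⁻¹ E[Σ_y F(y, o_j; ω) Δ(y)]`;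
* `tsum_eq_tsum_mul_relWeight_of_isGraphTransitive` — with one representative `o` (`Γo = V`)
  this is Timár's Lemma 2.2 (`Δ = w` with `w(o) = 1`).

## References

* Á. Timár, *Percolation on nonunimodular transitive graphs*, Ann. Probab. 34 (2006) 2344–2364
  (arXiv:math/0702875), §2: Lemma 2.2 and the paragraph after Lemma 2.1 (random transports);
  "At one point in the paper, we shall refer to quasi-transitive graphs". [Timar2006]
* R. Lyons, Y. Peres, *Probability on Trees and Networks*, CUP 2016, §8.2: Thm. 8.7, Thm. 8.10,
  (8.10), Cor. 8.11 and its proof; §8.1 (p. 389, expected transports); §7, p. 234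
  (quasi-transitive graphs). [LyonsPeres2016]
* T. Hutchcroft, C. R. Math. Acad. Sci. Paris 354 (2016) 944–947, §2 (Theorem (Timár) in
  quasi-transitive wording). [Hutchcroft2016]
* I. Benjamini, R. Lyons, Y. Peres, O. Schramm, *Group-invariant percolation on graphs*, GAFA 9
  (1999) 29–66, §3 (the mass-transport principle for quasi-transitive closed subgroups, Haar
  weights). [BenjaminiLyonsPeresSchramm1999b]
-/

noncomputable section

namespace Literature.Barriers.CriticalPhenomena

open scoped ENNReal

variable {V : Type*}

/-! ### Orbit representatives -/

/-- The **representative of the orbit of `v`** in a set `R` of vertices (meant to meet every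
`Aut(G)`-orbit exactly once; an arbitrary member of `R` in the orbit of `v`, and `v` itself if
there is none). [cite: LyonsPeres2016, Cor. 8.11 ("Choose a complete set {o_1, …, o_L} of representatives in V of the orbits of Γ")] -/
def orbitRep (G : SimpleGraph V) (R : Finset V) (v : V) : V := by
  classical
  exact if h : ∃ r ∈ R, v ∈ autOrbit G r then h.choose else v

section Rep

variable {G : SimpleGraph V} {R : Finset V}

/-- The representative lies in `R` and `v` lies in its orbit (when `R` meets every orbit).
[folklore] -/
theorem orbitRep_spec (hR : ∀ v : V, ∃ r ∈ R, v ∈ autOrbit G r) (v : V) :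
    orbitRep G R v ∈ R ∧ v ∈ autOrbit G (orbitRep G R v) := by
  classical
  have h : ∃ r ∈ R, v ∈ autOrbit G r := hR v
  have hdef : orbitRep G R v = h.choose := by
    unfold orbitRep
    rw [dif_pos h]
  rw [hdef]
  exact h.choose_spec

/-- The representative lies in `R`. [folklore] -/
theorem orbitRep_mem (hR : ∀ v : V, ∃ r ∈ R, v ∈ autOrbit G r) (v : V) : orbitRep G R v ∈ R :=
  (orbitRep_spec hR v).1

/-- `v` lies in the orbit of its representative. [folklore] -/
theorem mem_autOrbit_orbitRep (hR : ∀ v : V, ∃ r ∈ R, v ∈ autOrbit G r) (v : V) :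
    v ∈ autOrbit G (orbitRep G R v) :=
  (orbitRep_spec hR v).2

/-- If `R` meets no orbit twice, the representative of any vertex of the orbit of `r ∈ R` is `r`.
[folklore] -/
theorem orbitRep_eq_of_mem_autOrbit (hR : ∀ v : V, ∃ r ∈ R, v ∈ autOrbit G r)
    (hR' : ∀ r ∈ R, ∀ r' ∈ R, r' ∈ autOrbit G r → r = r') {r : V} (hr : r ∈ R) {v : V}
    (hv : v ∈ autOrbit G r) : orbitRep G R v = r := by
  refine (hR' r hr _ (orbitRep_mem hR v) ?_).symm
  obtain ⟨γ, hγ⟩ := hv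
  obtain ⟨δ, hδ⟩ := mem_autOrbit_orbitRep hR v
  refine ⟨γ.trans δ.symm, ?_⟩
  show δ.symm (γ r) = orbitRep G R v
  rw [hγ]
  exact δ.injective (by rw [δ.apply_symm_apply, hδ])

/-- Representatives of members of `R` are themselves. [folklore] -/
theorem orbitRep_eq_self (hR : ∀ v : V, ∃ r ∈ R, v ∈ autOrbit G r)
    (hR' : ∀ r ∈ R, ∀ r' ∈ R, r' ∈ autOrbit G r → r = r') {r : V} (hr : r ∈ R) :
    orbitRep G R r = r :=
  orbitRep_eq_of_mem_autOrbit hR hR' hr (mem_autOrbit_self G r)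

/-- **Representatives are `Aut(G)`-invariant**: `o(γ v) = o(v)`. [folklore] -/
theorem orbitRep_map (hR : ∀ v : V, ∃ r ∈ R, v ∈ autOrbit G r)
    (hR' : ∀ r ∈ R, ∀ r' ∈ R, r' ∈ autOrbit G r → r = r') (γ : G ≃g G) (v : V) :
    orbitRep G R (γ v) = orbitRep G R v := by
  refine orbitRep_eq_of_mem_autOrbit hR hR' (orbitRep_mem hR v) ?_
  obtain ⟨δ, hδ⟩ := mem_autOrbit_orbitRep hR v
  exact ⟨δ.trans γ, show γ (δ (orbitRep G R v)) = γ v by rw [hδ]⟩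

/-- Vertices of the orbit of `o_i ∈ R` have representative `o_i`, as a statement on the subtype.
[folklore] -/
theorem orbitRep_coe_autOrbit (hR : ∀ v : V, ∃ r ∈ R, v ∈ autOrbit G r)
    (hR' : ∀ r ∈ R, ∀ r' ∈ R, r' ∈ autOrbit G r → r = r') {i : V} (hi : i ∈ R)
    (y : autOrbit G i) : orbitRep G R y = i :=
  orbitRep_eq_of_mem_autOrbit hR hR' hi y.2

end Rep

/-! ### Relative weights `Δ(y) = μ_y / μ_{o(y)}` -/

/-- The **relative weight** of a vertex: its weight based at the representative of its own orbit,
`Δ(y) := w_{o(y)}(y) = |S(y) o(y)| / |S(o(y)) y| = μ_y / μ_{o(y)}`. It measures the position of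
`y` inside its orbit: `Δ ≡ 1` iff the graph is unimodular; on a transitive graph with `R = {o}` it
is Timár's weight `w(y)` (normalised by `w(o) = 1`).
[cite: Timar2006, §2 ("Fix some vertex o and define w(o) := 1. For each x ∈ V(G), let w(x) := |S_x o|/|S_o x|")]
[cite: LyonsPeres2016, Thm. 8.10] -/
def relWeight (G : SimpleGraph V) (R : Finset V) (y : V) : ℝ≥0∞ :=
  autWeight G (orbitRep G R y) y

section RelWeightBasic

/-- On the orbit of `o_i ∈ R`, `Δ(y) = w_{o_i}(y)`. [folklore] -/
theorem relWeight_eq_autWeight_of_mem_autOrbit {G : SimpleGraph V} {R : Finset V}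
    (hR : ∀ v : V, ∃ r ∈ R, v ∈ autOrbit G r)
    (hR' : ∀ r ∈ R, ∀ r' ∈ R, r' ∈ autOrbit G r → r = r') {i : V} (hi : i ∈ R) {y : V}
    (hy : y ∈ autOrbit G i) : relWeight G R y = autWeight G i y := by
  rw [relWeight, orbitRep_eq_of_mem_autOrbit hR hR' hi hy]

/-- **Transitive case**: with the single representative `o`, `Δ = w_o` (Timár's weights with
`w(o) = 1`). [cite: Timar2006, §2 (w(o) := 1, w(x) := |S_x o|/|S_o x|)] -/
theorem relWeight_singleton {G : SimpleGraph V} (ht : IsGraphTransitive G) (o y : V) :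
    relWeight G {o} y = autWeight G o y :=
  relWeight_eq_autWeight_of_mem_autOrbit (R := {o})
    (fun v => ⟨o, Finset.mem_singleton_self o, ht o v⟩)
    (fun r hr r' hr' _ => by
      rw [Finset.mem_singleton] at hr hr'
      rw [hr, hr'])
    (Finset.mem_singleton_self o) (ht o y)

end RelWeightBasic

section RelWeight

variable {G : SimpleGraph V} [G.LocallyFinite] (hconn : G.Connected) {R : Finset V}
include hconn

/-- Relative weights are nonzero. [folklore] -/
theorem relWeight_ne_zero (R : Finset V) (y : V) : relWeight G R y ≠ 0 :=
  autWeight_ne_zero G hconn _ y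

/-- Relative weights are finite. [folklore] -/
theorem relWeight_ne_top (R : Finset V) (y : V) : relWeight G R y ≠ ⊤ :=
  autWeight_ne_top G hconn _ y

/-- `Δ(y) · μ_{o(y)} = μ_y` for weights based at any `o`. [cite: LyonsPeres2016, Thm. 8.10 (weights unique up to a constant multiple)] -/
theorem relWeight_mul_autWeight_orbitRep (R : Finset V) (o y : V) :
    relWeight G R y * autWeight G o (orbitRep G R y) = autWeight G o y :=
  autWeight_base_mul G hconn o (orbitRep G R y) y

/-- The representatives themselves have relative weight `1`. [folklore] -/
theorem relWeight_eq_one_of_mem (hR : ∀ v : V, ∃ r ∈ R, v ∈ autOrbit G r)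
    (hR' : ∀ r ∈ R, ∀ r' ∈ R, r' ∈ autOrbit G r → r = r') {r : V} (hr : r ∈ R) :
    relWeight G R r = 1 := by
  rw [relWeight, orbitRep_eq_self hR hR' hr, autWeight_self G hconn r]

/-- **Unimodular case**: `Δ ≡ 1` ("`Γ` is unimodular iff `μ_y = μ_x` whenever `y ∈ Γx`").
[cite: LyonsPeres2016, §8.2 (remark after the proof of Thm. 8.10)] -/
theorem relWeight_eq_one_of_isGraphUnimodular (hU : IsGraphUnimodular G)
    (hR : ∀ v : V, ∃ r ∈ R, v ∈ autOrbit G r) (y : V) : relWeight G R y = 1 := by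
  rw [relWeight, ← autWeight_self G hconn (orbitRep G R y)]
  exact (autWeight_eq_of_isGraphUnimodular G hconn hU (orbitRep G R y)
    (mem_autOrbit_orbitRep hR y)).symm

/-- **Automorphisms rescale relative weights by the same factor as weights**:
`Δ(γ y) · μ_y = Δ(y) · μ_{γ y}` (the representative is invariant, `orbitRep_map`, and
`w(γ y)/w(y)` does not depend on the base). [cite: Timar2006, §5 (automorphisms act on weights by a constant factor)] -/
theorem relWeight_map_mul (hR : ∀ v : V, ∃ r ∈ R, v ∈ autOrbit G r)
    (hR' : ∀ r ∈ R, ∀ r' ∈ R, r' ∈ autOrbit G r → r = r') (γ : G ≃g G) (o y : V) :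
    relWeight G R (γ y) * autWeight G o y = relWeight G R y * autWeight G o (γ y) := by
  have h1 := relWeight_mul_autWeight_orbitRep hconn R o (γ y)
  have h2 := relWeight_mul_autWeight_orbitRep hconn R o y
  rw [orbitRep_map hR hR' γ y] at h1
  -- `Δ(γy) μ_rep = μ_{γy}`, `Δ(y) μ_rep = μ_y`; cross-multiply
  have hr0 := autWeight_ne_zero G hconn o (orbitRep G R y)
  have hrT := autWeight_ne_top G hconn o (orbitRep G R y)
  rw [← ENNReal.mul_left_inj hr0 hrT]
  calc relWeight G R (γ y) * autWeight G o y * autWeight G o (orbitRep G R y)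
      = (relWeight G R (γ y) * autWeight G o (orbitRep G R y)) * autWeight G o y := by ring
    _ = autWeight G o (γ y) * (relWeight G R y * autWeight G o (orbitRep G R y)) := by
        rw [h1, h2, mul_comm]
    _ = relWeight G R y * autWeight G o (γ y) * autWeight G o (orbitRep G R y) := by ring

end RelWeight

/-! ### (8.10) divided by `μ_i μ_j`, and the quasi-transitive nonunimodular MTP -/

section MTP

variable (G : SimpleGraph V) [G.LocallyFinite]

/-- **The two-orbit identity, nonunimodular form**: for orbit representatives `o_i, o_j` (any two
vertices), weights based at any `o`, and a diagonally invariant `f`,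
`μ_i⁻¹ Σ_{z ∈ Γo_j} f(o_i, z) = μ_j⁻¹ Σ_{y ∈ Γo_i} f(y, o_j) w_{o_i}(y)` — Lyons–Peres (8.10)
`(Σ_{z ∈ Γo_j} f(o_i, z)) μ_j = Σ_{y ∈ Γo_i} f(y, o_j) μ_y` with `μ_y = w_{o_i}(y) μ_i` (change of
base, `autWeight_base_mul`), divided by `μ_i μ_j ∈ (0, ∞)`. In the unimodular case
`w_{o_i} ≡ 1` on `Γo_i` and this is the identity of the printed proof of Cor. 8.11.
[cite: LyonsPeres2016, §8.2 ((8.10)) and Cor. 8.11 (proof)] [cite: Timar2006, Lemma 2.2] -/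
theorem inv_autWeight_mul_tsum_autOrbit_eq_tilted (hconn : G.Connected) {f : V → V → ℝ≥0∞}
    (hf : ∀ (γ : G ≃g G) (x y : V), f (γ x) (γ y) = f x y) (o oi oj : V) :
    (autWeight G o oi)⁻¹ * ∑' z : autOrbit G oj, f oi z =
      (autWeight G o oj)⁻¹ * ∑' y : autOrbit G oi, f y oj * autWeight G oi y := by
  have h := tsum_autOrbit_mul_autWeight_eq G hconn hf o oi oj
  -- `μ_y = w_{o_i}(y) μ_i`
  have h' : ∑' y : autOrbit G oi, f y oj * autWeight G o y =
      (∑' y : autOrbit G oi, f y oj * autWeight G oi y) * autWeight G o oi := by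
    rw [← ENNReal.tsum_mul_right]
    refine tsum_congr fun y => ?_
    rw [mul_assoc, autWeight_base_mul G hconn o oi y]
  rw [h'] at h
  have hi0 := autWeight_ne_zero G hconn o oi
  have hiT := autWeight_ne_top G hconn o oi
  have hj0 := autWeight_ne_zero G hconn o oj
  have hjT := autWeight_ne_top G hconn o oj
  set A := ∑' z : autOrbit G oj, f oi z with hA
  set B := ∑' y : autOrbit G oi, f y oj * autWeight G oi y with hB
  calc (autWeight G o oi)⁻¹ * A
      = (autWeight G o oi)⁻¹ * (A * autWeight G o oj * (autWeight G o oj)⁻¹) := by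
        rw [mul_assoc A, ENNReal.mul_inv_cancel hj0 hjT, mul_one]
    _ = (autWeight G o oi)⁻¹ * (B * autWeight G o oi * (autWeight G o oj)⁻¹) := by rw [h]
    _ = (autWeight G o oi)⁻¹ * autWeight G o oi * B * (autWeight G o oj)⁻¹ := by ring
    _ = (autWeight G o oj)⁻¹ * B := by
        rw [ENNReal.inv_mul_cancel hi0 hiT, one_mul, mul_comm]

/-- **The nonunimodular mass-transport principle on a quasi-transitive graph, PROVED** (Timár's
Lemma 2.2 in quasi-transitive form; Lyons–Peres (8.10) summed over orbit representatives as in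
the proof of Cor. 8.11): for `G` connected and locally finite, `R = {o_1, …, o_L}` meeting every
`Aut(G)`-orbit exactly once (quasi-transitivity is the existence of such an `R`,
`IsQuasiTransitive.exists_orbit_representatives`), weights `μ = autWeight G o` (any base `o`) and
`f : V × V → [0, ∞]` invariant under the diagonal action of `Aut(G)`,
`Σ_i μ_{o_i}⁻¹ Σ_z f(o_i, z) = Σ_j μ_{o_j}⁻¹ Σ_y f(y, o_j) Δ(y)` with the relative weights
`Δ = relWeight G R`. For transitive `G` and `R = {o}` this reads
`Σ_z f(o, z) = Σ_y f(y, o) w(y)` with `w(o) = 1` (Lemma 2.2); for unimodular `G`, `Δ ≡ 1`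
(Cor. 8.11). [cite: Timar2006, Lemma 2.2] [cite: LyonsPeres2016, §8.2 ((8.10), Cor. 8.11 and its proof)] -/
theorem sum_inv_autWeight_mul_tsum_eq_tilted (hconn : G.Connected) (R : Finset V)
    (hR : ∀ v : V, ∃ r ∈ R, v ∈ autOrbit G r)
    (hR' : ∀ r ∈ R, ∀ r' ∈ R, r' ∈ autOrbit G r → r = r') {f : V → V → ℝ≥0∞}
    (hf : ∀ (γ : G ≃g G) (x y : V), f (γ x) (γ y) = f x y) (o : V) :
    ∑ i ∈ R, (autWeight G o i)⁻¹ * ∑' z, f i z =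
      ∑ j ∈ R, (autWeight G o j)⁻¹ * ∑' y, f y j * relWeight G R y := by
  calc ∑ i ∈ R, (autWeight G o i)⁻¹ * ∑' z, f i z
      = ∑ i ∈ R, ∑ j ∈ R, (autWeight G o i)⁻¹ * ∑' z : autOrbit G j, f i z := by
        refine Finset.sum_congr rfl fun i _ => ?_
        rw [tsum_eq_sum_tsum_autOrbit R hR hR' (f i), Finset.mul_sum]
    _ = ∑ i ∈ R, ∑ j ∈ R, (autWeight G o j)⁻¹ *
          ∑' y : autOrbit G i, f y j * relWeight G R y := by
        refine Finset.sum_congr rfl fun i hi => Finset.sum_congr rfl fun j _ => ?_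
        rw [inv_autWeight_mul_tsum_autOrbit_eq_tilted G hconn hf o i j]
        congr 1
        refine tsum_congr fun y => ?_
        rw [relWeight_eq_autWeight_of_mem_autOrbit hR hR' hi y.2]
    _ = ∑ j ∈ R, ∑ i ∈ R, (autWeight G o j)⁻¹ *
          ∑' y : autOrbit G i, f y j * relWeight G R y := Finset.sum_comm
    _ = ∑ j ∈ R, (autWeight G o j)⁻¹ * ∑' y, f y j * relWeight G R y := by
        refine Finset.sum_congr rfl fun j _ => ?_
        rw [tsum_eq_sum_tsum_autOrbit R hR hR' (fun y => f y j * relWeight G R y), Finset.mul_sum]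

/-- **Timár's Lemma 2.2 recovered**: on a transitive graph, with the single representative `o`,
the quasi-transitive MTP reads `Σ_z f(o, z) = Σ_y f(y, o) Δ(y)` with `Δ = w_o` — "Let `G` be a
transitive nonunimodular graph and `f(x, y)` … diagonally invariant under `Aut(G)`. Then
`Σ_y f(x, y) = w(x)⁻¹ Σ_y f(y, x) w(y)`" at `x = o`, `w(o) = 1`.
[cite: Timar2006, Lemma 2.2] -/
theorem tsum_eq_tsum_mul_relWeight_of_isGraphTransitive (hconn : G.Connected)
    (ht : IsGraphTransitive G) {f : V → V → ℝ≥0∞}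
    (hf : ∀ (γ : G ≃g G) (x y : V), f (γ x) (γ y) = f x y) (o : V) :
    ∑' z, f o z = ∑' y, f y o * relWeight G {o} y := by
  have hR : ∀ v : V, ∃ r ∈ ({o} : Finset V), v ∈ autOrbit G r :=
    fun v => ⟨o, Finset.mem_singleton_self o, ht o v⟩
  have hR' : ∀ r ∈ ({o} : Finset V), ∀ r' ∈ ({o} : Finset V), r' ∈ autOrbit G r → r = r' :=
    fun r hr r' hr' _ => by
      rw [Finset.mem_singleton] at hr hr'
      rw [hr, hr']
  have h := sum_inv_autWeight_mul_tsum_eq_tilted G hconn {o} hR hR' hf o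
  rw [Finset.sum_singleton, Finset.sum_singleton, autWeight_self G hconn o, inv_one, one_mul,
    one_mul] at h
  exact h

end MTP

/-! ### Invariant random transports -/

section Random

open _root_.MeasureTheory

variable {Ω : Type*} [MeasurableSpace Ω]

/-- **The quasi-transitive nonunimodular MTP for invariant random transports, PROVED** ("We shall
typically define a function `φ` on `V(G) × V(G) × 2^G` with `φ(x, y; ω) = φ(γx, γy; γω)` … '`x`
sends mass `φ(x, y; ω)` to `y` when `ω`' … Then `f(x, y)` is defined as `E[φ(x, y; ω)]`", Timár
2006, §2): for a measure `P` on `Ω` preserved by measurable maps `act γ` (`γ ∈ Aut(G)`), a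
measurable `F(x, y; ω) ∈ [0, ∞]` with `F(γx, γy; γω) = F(x, y; ω)`, `G` connected locally finite,
`R` a complete set of orbit representatives and weights based at any `o`:
`Σ_i μ_{o_i}⁻¹ E[Σ_x F(o_i, x; ω)] = Σ_j μ_{o_j}⁻¹ E[Σ_y F(y, o_j; ω) Δ(y)]`.
[cite: Timar2006, Lemma 2.2 (and the paragraph following Lemma 2.1)]
[cite: LyonsPeres2016, §8.1 (p. 389, f(x,y) := E F(x,y;ω)) and §8.2 ((8.10))] -/
theorem sum_inv_autWeight_mul_lintegral_tsum_eq_tilted (G : SimpleGraph V) [G.LocallyFinite]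
    (hconn : G.Connected) (R : Finset V) (hR : ∀ v : V, ∃ r ∈ R, v ∈ autOrbit G r)
    (hR' : ∀ r ∈ R, ∀ r' ∈ R, r' ∈ autOrbit G r → r = r')
    (P : Measure Ω) (act : (G ≃g G) → Ω → Ω) (hact : ∀ γ, Measurable (act γ))
    (hP : ∀ γ, P.map (act γ) = P) {F : V → V → Ω → ℝ≥0∞} (hF : ∀ x y, Measurable (F x y))
    (hinv : ∀ (γ : G ≃g G) (x y : V) (ω : Ω), F (γ x) (γ y) (act γ ω) = F x y ω) (o : V) :
    ∑ i ∈ R, (autWeight G o i)⁻¹ * ∫⁻ ω, ∑' x, F i x ω ∂P =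
      ∑ j ∈ R, (autWeight G o j)⁻¹ * ∫⁻ ω, ∑' y, F y j ω * relWeight G R y ∂P := by
  rcases isEmpty_or_nonempty V with hV | ⟨⟨v₀⟩⟩
  · rw [Finset.eq_empty_of_isEmpty R, Finset.sum_empty, Finset.sum_empty]
  haveI : Countable V := countable_of_connected_of_locallyFinite G hconn v₀
  have h := sum_inv_autWeight_mul_tsum_eq_tilted G hconn R hR hR' (f := fun x y => ∫⁻ ω, F x y ω ∂P)
    (fun γ x y => lintegral_diagInvariant P act hact hP hF hinv γ x y) o
  simp_rw [lintegral_tsum fun x => (hF _ x).aemeasurable]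
  rw [h]
  refine Finset.sum_congr rfl fun j _ => ?_
  congr 1
  rw [lintegral_tsum fun y => ((hF y j).mul_const _).aemeasurable]
  refine tsum_congr fun y => ?_
  rw [lintegral_mul_const _ (hF y j)]

/-- **One-sided consequence used throughout Timár's §5** (the shape of Lemma 5.1 / Lemma 5.3:
"the expected mass sent out is … the expected mass received …" with a weight bound): if every
transport `y → o_j` with `F(y, o_j; ω) ≠ 0` has `Δ(y) ≤ B`, then
`Σ_i μ_{o_i}⁻¹ E[Σ_x F(o_i, x)] ≤ B · Σ_j μ_{o_j}⁻¹ E[Σ_y F(y, o_j)]`.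
[cite: Timar2006, Lemma 5.1 (proof: "E[mass sent out] ≤ μ E[mass received]")] -/
theorem sum_inv_autWeight_mul_lintegral_tsum_le_of_relWeight_le (G : SimpleGraph V)
    [G.LocallyFinite] (hconn : G.Connected) (R : Finset V)
    (hR : ∀ v : V, ∃ r ∈ R, v ∈ autOrbit G r)
    (hR' : ∀ r ∈ R, ∀ r' ∈ R, r' ∈ autOrbit G r → r = r')
    (P : Measure Ω) (act : (G ≃g G) → Ω → Ω) (hact : ∀ γ, Measurable (act γ))
    (hP : ∀ γ, P.map (act γ) = P) {F : V → V → Ω → ℝ≥0∞} (hF : ∀ x y, Measurable (F x y))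
    (hinv : ∀ (γ : G ≃g G) (x y : V) (ω : Ω), F (γ x) (γ y) (act γ ω) = F x y ω) (o : V)
    {B : ℝ≥0∞} (hBtop : B ≠ ⊤)
    (hB : ∀ (y : V), ∀ j ∈ R, ∀ ω, F y j ω ≠ 0 → relWeight G R y ≤ B) :
    ∑ i ∈ R, (autWeight G o i)⁻¹ * ∫⁻ ω, ∑' x, F i x ω ∂P ≤
      B * ∑ j ∈ R, (autWeight G o j)⁻¹ * ∫⁻ ω, ∑' y, F y j ω ∂P := by
  rw [sum_inv_autWeight_mul_lintegral_tsum_eq_tilted G hconn R hR hR' P act hact hP hF hinv o,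
    Finset.mul_sum]
  refine Finset.sum_le_sum fun j hj => ?_
  rw [mul_left_comm]
  refine mul_le_mul' le_rfl ?_
  rw [← lintegral_const_mul' B _ hBtop]
  refine lintegral_mono fun ω => ?_
  rw [← ENNReal.tsum_mul_left]
  refine ENNReal.tsum_le_tsum fun y => ?_
  by_cases h0 : F y j ω = 0
  · simp [h0]
  · rw [mul_comm B]
    exact mul_le_mul' le_rfl (hB y j hj ω h0)

end Random

end Literature.Barriers.CriticalPhenomena

end
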